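import Literature.NumberTheory.EllipticCurves.KodairaNeronUnramifiedInertiaProofs
import Literature.NumberTheory.EllipticCurves.InertiaTameFactorizationProofs
import Literature.NumberTheory.EllipticCurves.SerreOpenImageReductionInertiaProofs
import Literature.NumberTheory.GaloisRepresentations.UnramifiedKummerOrbitProofs
import Literature.NumberTheory.GaloisRepresentations.HeckeCharacterProofs
import HarnessLib

/-!
# An element of `ℚ̄` of valuation `-1/d` at the place over `ℓ` has at least `d` conjugates under
# the inertia group `I_𝔓` (Serre 1972, §1.3; Serre, *Local Fields*, Ch. I §6–7)

`Proofs` file (theorems only: no definition, no named fact), topic `NumberTheory/EllipticCurves`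
(it serves the Serre/Wuthrich image theorems; the content is algebraic number theory).  Let `ℓ` be
a prime, `𝒪 = placeOver ℓ ⊂ ℚ̄` the tree's place over `ℓ` (`GeomPointReduction`) with valuation
`v` and prime `𝔓 = 𝔪 ∩ \bar ℤ` (`exists_ideal_placeOver`), and `I_𝔓 ≤ Γ_ℚ` its inertia group.

* `Literature.NumberTheory.EllipticCurves.valuationSubring_eq_of_forall_mem_iff_nonunits` — two
  valuation subrings of an algebraic extension `L/K` of the fraction field of a Dedekind domain `R`
  containing `S = \bar R` whose non-units contract to the SAME prime `𝔓` of `S` coincide (both are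
  `S_𝔓`: `Ideal.exists_mul_eq_of_mem_valuationSubring`; Serre, *Local Fields*, Ch. I §7,
  Prop. 19–21);
* `….mem_placeOver_iff_spectralValuation_le_one` — hence, for a `ℚ`-embedding
  `ι : ℚ̄ → \bar ℚ_v` cutting out `𝔓` (`primeBelow ι 𝔐 = 𝔓`, `InertiaTame.exists_primeBelow_eq`),
  **`z ∈ 𝒪_𝔓 ↔ |ι z|_v ≤ 1`**: the place is the pull-back of the spectral valuation of `\bar ℚ_v`;
* `….exists_inertia_smul_injective_of_valuation_pow_mul_eq_one` — **if `v(z) ^ d · v(ℓ) = 1`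
  (`d ≥ 1`), there are `s₀, …, s_{d-1} ∈ I_𝔓` with `s_i z` pairwise distinct**: transport of the
  local statement `IsNonarchimedeanLocalField.exists_absInertia_smul_injective_of_algNorm_pow_mul_eq_one`
  (`GaloisRepresentations/UnramifiedKummerOrbitProofs`: over `\bar ℚ_v`, `ι z` has `≥ d`
  conjugates under `I_{ℚ_v} = Aut(\bar ℚ_v/ℚ_v^nr)`, because its minimal polynomial over the
  maximal unramified extension has degree `≥ d`) along `resGalOfEmb ι : Γ_{ℚ_v} → Γ_ℚ`, which maps
  the local inertia group into `I_𝔓` (`resGalOfEmb_mem_inertia_primeBelow`, `inertia_eq_absInertia`)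
  compatibly with `ι` (`apply_resGalOfEmb_smul`).

Use (cell `b2b-bsdres`, team n1011, row T-b1ss): at a good supersingular `3`, the abscissa of a
point `P` with `3 • P ∈ E[3] ∖ 0` has `v(x)^{36} v(3) = 1`
(`SupersingularTorsionValuationLevelTwoProofs`), so `P` has `≥ 36` conjugates under `I_𝔓` — more
than the `8 · 3 = 24` allowed if every inertia element congruent to `1 mod 3` acted as a scalar on
`E[9]`; this produces the first-order witness for the `3`-adic tower (Wuthrich 2014, Lemma 20).

## References

* [SerreInventiones1972] J.-P. Serre, Invent. Math. 15 (1972) 259–331, §1.2–1.3.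
* [SerreLocalFields1979] J.-P. Serre, *Local Fields*, GTM 67 (1979), Ch. I §6–7 (Prop. 19–21),
  Ch. II §3.
* [NeukirchANT1999] J. Neukirch, *Algebraic Number Theory*, Ch. II (6.2), (8.1), (9.3).
-/

noncomputable section

open scoped Classical NNReal NumberField Pointwise
open IsDedekindDomain Field NumberField ValuativeRel

namespace Literature.NumberTheory.EllipticCurves

open Literature.NumberTheory.GaloisRepresentations Rat.HeightOneSpectrum
  Literature.NumberTheory.GaloisRepresentations.IsNonarchimedeanLocalField

/-! ### The uniformiser of `𝒪[F]` read in `F̄` -/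

section Generic

variable {F : Type*} [Field F] [ValuativeRel F]

/-- `𝒪[F] → F̄` factors through `F`: `algebraMap 𝒪[F] F̄ ϖ = algebraMap F F̄ ϖ`. [folklore] -/
private theorem algebraMap_integer_algebraicClosure_apply (ϖ : 𝒪[F]) :
    algebraMap 𝒪[F] (AlgebraicClosure F) ϖ = algebraMap F (AlgebraicClosure F) (ϖ : F) := by
  rw [IsScalarTower.algebraMap_apply 𝒪[F] F (AlgebraicClosure F)]
  rfl

end Generic

/-! ### Valuation subrings with the same centre coincide -/

section Centre

variable (R K : Type*) {L : Type*} [CommRing R] [Field K] [Field L] [Algebra R K] [Algebra R L]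
  [Algebra K L] [IsScalarTower R K L] [IsDedekindDomain R] [IsFractionRing R K]
  [Algebra.IsAlgebraic K L]

include K in

/-- **Two valuation subrings with the same centre coincide.**  Let `R` be a Dedekind domain with
fraction field `K`, `L/K` algebraic, `S = integralClosure R L`, and `A, B` valuation subrings of
`L` containing `S` whose non-units contract to the same ideal `𝔓` of `S`.  Then `A ≤ B` (and by
symmetry `A = B`): every `z ∈ A` is `s/t` with `s ∈ S`, `t ∈ S ∖ 𝔓`
(`Ideal.exists_mul_eq_of_mem_valuationSubring`), and `t` is a unit of `B`.  (Both rings are the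
localisation `S_𝔓`; Serre, *Local Fields*, Ch. I §7, Prop. 21.)
[cite: SerreLocalFields1979, Ch. I §7 Prop. 19–21] -/
theorem valuationSubring_le_of_forall_mem_iff_nonunits (A B : ValuationSubring L)
    (hB : ∀ x : integralClosure R L, (x : L) ∈ B) (𝔓 : Ideal (integralClosure R L))
    (h𝔓A : ∀ x : integralClosure R L, x ∈ 𝔓 ↔ (x : L) ∈ A.nonunits)
    (h𝔓B : ∀ x : integralClosure R L, x ∈ 𝔓 ↔ (x : L) ∈ B.nonunits) : A ≤ B := by
  intro z hz
  obtain ⟨s, t, ht, hzt⟩ := Ideal.exists_mul_eq_of_mem_valuationSubring R (K := K) A 𝔓 h𝔓A hz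
  have htB : (t : L) ∈ B := hB t
  have htunit : B.valuation (t : L) = 1 := by
    have h1 : B.valuation (t : L) ≤ 1 := (B.valuation_le_one_iff _).mpr htB
    have h2 : ¬ B.valuation (t : L) < 1 := by
      rw [← ValuationSubring.mem_nonunits_iff, ← h𝔓B]; exact ht
    exact le_antisymm h1 (not_lt.mp h2)
  have ht0 : (t : L) ≠ 0 := by
    intro h0
    rw [h0, map_zero] at htunit
    exact zero_ne_one htunit
  have htinv : (t : L)⁻¹ ∈ B := by
    rw [← B.valuation_le_one_iff, map_inv₀, htunit, inv_one]
  have hz' : z = (s : L) * (t : L)⁻¹ := by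
    rw [← hzt, mul_inv_cancel_right₀ ht0]
  rw [hz']
  exact B.mul_mem _ _ (hB s) htinv

include K in
/-- **Two valuation subrings with the same centre coincide** (symmetric form of
`valuationSubring_le_of_forall_mem_iff_nonunits`). [cite: SerreLocalFields1979, Ch. I §7 Prop. 19–21] -/
theorem valuationSubring_eq_of_forall_mem_iff_nonunits (A B : ValuationSubring L)
    (hA : ∀ x : integralClosure R L, (x : L) ∈ A) (hB : ∀ x : integralClosure R L, (x : L) ∈ B)
    (𝔓 : Ideal (integralClosure R L))
    (h𝔓A : ∀ x : integralClosure R L, x ∈ 𝔓 ↔ (x : L) ∈ A.nonunits)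
    (h𝔓B : ∀ x : integralClosure R L, x ∈ 𝔓 ↔ (x : L) ∈ B.nonunits) : A = B :=
  le_antisymm (valuationSubring_le_of_forall_mem_iff_nonunits R K A B hB 𝔓 h𝔓A h𝔓B)
    (valuationSubring_le_of_forall_mem_iff_nonunits R K B A hA 𝔓 h𝔓B h𝔓A)

end Centre

/-! ### The place over `ℓ` is the pull-back of the spectral valuation along an adapted embedding -/

section Bridge

variable (ℓ : ℕ) [Fact ℓ.Prime] {v : HeightOneSpectrum (𝓞 ℚ)}
  {w : Valuation (AlgebraicClosure (v.adicCompletion ℚ)) ℝ≥0}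
  (hw : ∀ x, (w x : ℝ) =
    spectralNorm (v.adicCompletion ℚ) (AlgebraicClosure (v.adicCompletion ℚ)) x)
  {𝔐 : Ideal v.localAbsIntegers} (h𝔐 : 𝔐 ∈ v.localPrimesAbove)
  (ι : AlgebraicClosure ℚ →ₐ[ℚ] AlgebraicClosure (v.adicCompletion ℚ))
  {𝔓 : Ideal (absIntegers (𝓞 ℚ) ℚ)}
  (hmem : ∀ x : absIntegers (𝓞 ℚ) ℚ, x ∈ 𝔓 ↔ (x : AlgebraicClosure ℚ) ∈ (placeOver ℓ).nonunits)
  (hι : v.primeBelow ι 𝔐 = 𝔓)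
include hw h𝔐 hmem hι

/-- **The place is the pull-back of `|·|_v`**: for an embedding `ι : ℚ̄ → \bar ℚ_v` with
`ι⁻¹(𝔐) ∩ \bar ℤ = 𝔓` the prime of the place `placeOver ℓ`, one has `z ∈ 𝒪_𝔓 ↔ |ι z|_v ≤ 1` for
every `z ∈ ℚ̄` — the valuation ring `𝒪_𝔓` and the pull-back of the valuation ring of `\bar ℚ_v`
are valuation subrings of `ℚ̄` containing `\bar ℤ` with the same centre `𝔓`
(`mem_iff_spectralValuation_lt_one`, `mem_primeBelow_iff`), hence equal
(`valuationSubring_eq_of_forall_mem_iff_nonunits`).  Neukirch, *ANT*, Ch. II (8.1) (the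
extensions of `v` to `ℚ̄` are the `\bar v ∘ ι`); Serre, *Local Fields*, Ch. I §7.
[cite: SerreLocalFields1979, Ch. I §7 Prop. 19–21] [cite: NeukirchANT1999, Ch. II (8.1)] -/
theorem mem_placeOver_iff_spectralValuation_le_one (z : AlgebraicClosure ℚ) :
    z ∈ placeOver ℓ ↔ w (ι z) ≤ 1 := by
  -- the pulled-back valuation ring `B`
  set u : Valuation (AlgebraicClosure ℚ) ℝ≥0 := w.comap ι.toRingHom with hu
  set B : ValuationSubring (AlgebraicClosure ℚ) := u.valuationSubring with hBdef
  have hmemB : ∀ y : AlgebraicClosure ℚ, y ∈ B ↔ w (ι y) ≤ 1 := fun y ↦ by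
    rw [hBdef, Valuation.mem_valuationSubring_iff]; rfl
  have hBnon : ∀ y : AlgebraicClosure ℚ, y ∈ B.nonunits ↔ w (ι y) < 1 := fun y ↦ by
    rw [ValuationSubring.mem_nonunits_iff,
      ← (Valuation.isEquiv_valuation_valuationSubring u).lt_one_iff_lt_one]
    rfl
  -- `\bar ℤ ⊆ B` and `𝔓 = 𝔪_B ∩ \bar ℤ`
  have hB : ∀ x : absIntegers (𝓞 ℚ) ℚ, (x : AlgebraicClosure ℚ) ∈ B := by
    intro x
    rw [hmemB, ← HeightOneSpectrum.mem_localAbsIntegers_iff_spectralValuation hw]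
    exact (mem_integralClosure_iff _ _).mpr
      (HeightOneSpectrum.isIntegral_apply_of_mem_absIntegers v ι x.2)
  have h𝔓B : ∀ x : absIntegers (𝓞 ℚ) ℚ, x ∈ 𝔓 ↔ (x : AlgebraicClosure ℚ) ∈ B.nonunits := by
    intro x
    rw [hBnon, ← hι, HeightOneSpectrum.mem_primeBelow_iff,
      HeightOneSpectrum.mem_iff_spectralValuation_lt_one hw h𝔐]
    rfl
  have hA : ∀ x : absIntegers (𝓞 ℚ) ℚ, (x : AlgebraicClosure ℚ) ∈ placeOver ℓ :=
    coe_absIntegers_mem_placeOver ℓ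
  haveI : Algebra.IsAlgebraic ℚ (AlgebraicClosure ℚ) := AlgebraicClosure.isAlgebraic ℚ
  have heq : placeOver ℓ = B :=
    valuationSubring_eq_of_forall_mem_iff_nonunits (𝓞 ℚ) ℚ (placeOver ℓ) B hA hB 𝔓 hmem h𝔓B
  rw [heq]
  exact hmemB z

/-- Consequently `v_𝔓(z) < 1 ↔ |ι z|_v < 1`. [cite: SerreLocalFields1979, Ch. I §7 Prop. 19–21] -/
theorem valuation_placeOver_lt_one_iff_spectralValuation_lt_one (z : AlgebraicClosure ℚ) :
    (placeOver ℓ).valuation z < 1 ↔ w (ι z) < 1 := by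
  by_cases hz : z = 0
  · subst hz; simp
  have h1 := mem_placeOver_iff_spectralValuation_le_one ℓ hw h𝔐 ι hmem hι z⁻¹
  rw [← ValuationSubring.valuation_le_one_iff, map_inv₀, map_inv₀, map_inv₀] at h1
  have hz1 : (placeOver ℓ).valuation z ≠ 0 := by rwa [ne_eq, map_eq_zero]
  have hz2 : w (ι z) ≠ 0 := by rwa [ne_eq, map_eq_zero, map_eq_zero]
  rw [inv_le_one₀ (zero_lt_iff.mpr hz1), inv_le_one₀ (zero_lt_iff.mpr hz2)] at h1
  constructor
  · intro h; by_contra h'; exact (not_le.mpr h) (h1.mpr (not_lt.mp h'))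
  · intro h; by_contra h'; exact (not_le.mpr h) (h1.mp (not_lt.mp h'))

/-- Consequently `v_𝔓(z) = 1 ↔ |ι z|_v = 1`. [cite: SerreLocalFields1979, Ch. I §7 Prop. 19–21] -/
theorem valuation_placeOver_eq_one_iff_spectralValuation_eq_one (z : AlgebraicClosure ℚ) :
    (placeOver ℓ).valuation z = 1 ↔ w (ι z) = 1 := by
  have hle := mem_placeOver_iff_spectralValuation_le_one ℓ hw h𝔐 ι hmem hι z
  rw [← ValuationSubring.valuation_le_one_iff] at hle
  have hlt := valuation_placeOver_lt_one_iff_spectralValuation_lt_one ℓ hw h𝔐 ι hmem hι z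
  constructor
  · intro h
    exact le_antisymm (hle.mp h.le) (not_lt.mp fun h' ↦ (lt_irrefl _) (h ▸ hlt.mpr h'))
  · intro h
    exact le_antisymm (hle.mpr h.le) (not_lt.mp fun h' ↦ (lt_irrefl _) (h ▸ hlt.mp h'))

end Bridge

/-! ### At least `d` inertia conjugates -/

/-- **An element of valuation `-1/d` at the place over `ℓ` has `≥ d` conjugates under `I_𝔓`.**
Let `𝔓` be the prime of `\bar ℤ` cut out by the place `placeOver ℓ` (`hmem`), `d ≥ 1`, and
`z ∈ ℚ̄` with `v(z) ^ d · v(ℓ) = 1` for the place's valuation `v`.  Then there are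
`s₀, …, s_{d-1}` in the inertia group `I_𝔓 ≤ Γ_ℚ` such that the `s_i z` are pairwise distinct.
Proof: choose `ι : ℚ̄ → \bar ℚ_v` adapted to `𝔓` (`InertiaTame.exists_primeBelow_eq`); by the
bridge `|ι z|_v^d · |ℓ|_v = 1`, so `ι z` has `≥ d` conjugates under `I_{ℚ_v}` (local theorem
`exists_absInertia_smul_injective_of_algNorm_pow_mul_eq_one`: its minimal polynomial over the
maximal unramified extension has degree `≥ d`); restrict them to `Γ_ℚ` (`resGalOfEmb`): they land
in `I_𝔓` (`resGalOfEmb_mem_inertia_primeBelow`) and act on `z` through `ι`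
(`apply_resGalOfEmb_smul`).  Serre, Invent. Math. 15 (1972), §1.3 (`K_d/K_nr` totally ramified of
degree `d`), read on orbits. [cite: SerreInventiones1972, §1.3]
[cite: SerreLocalFields1979, Ch. I §6–7] [cite: NeukirchANT1999, Ch. II (8.1), (9.3)] -/
theorem exists_inertia_smul_injective_of_valuation_pow_mul_eq_one (ℓ : ℕ) [Fact ℓ.Prime]
    {𝔓 : Ideal (absIntegers (𝓞 ℚ) ℚ)}
    (hmem : ∀ x : absIntegers (𝓞 ℚ) ℚ, x ∈ 𝔓 ↔ (x : AlgebraicClosure ℚ) ∈ (placeOver ℓ).nonunits)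
    {d : ℕ} (hd : 0 < d) {z : AlgebraicClosure ℚ}
    (hz : (placeOver ℓ).valuation z ^ d * (placeOver ℓ).valuation (ℓ : AlgebraicClosure ℚ) = 1) :
    ∃ s : Fin d → absoluteGaloisGroup ℚ,
      (∀ i, s i ∈ 𝔓.inertia (absoluteGaloisGroup ℚ)) ∧ Function.Injective fun i ↦ s i • z := by
  have hp : ℓ.Prime := Fact.out
  -- the place `v` of `ℚ` at `ℓ`; `𝔓 ∈ v.primesAbove`
  obtain ⟨v, hv⟩ : ∃ v : HeightOneSpectrum (𝓞 ℚ), (Rat.HeightOneSpectrum.primesEquiv v : ℕ) = ℓ :=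
    ⟨(Rat.HeightOneSpectrum.primesEquiv (R := 𝓞 ℚ)).symm ⟨ℓ, hp⟩, by rw [Equiv.apply_symm_apply]⟩
  obtain ⟨𝔓₀, hmem₀, h𝔓₀v⟩ := exists_ideal_placeOver ℓ hv
  have h𝔓eq : 𝔓 = 𝔓₀ := by
    ext x; rw [hmem, hmem₀]
  have h𝔓v : 𝔓 ∈ v.primesAbove := h𝔓eq ▸ h𝔓₀v
  -- local data: a prime `𝔐` of `\bar 𝓞_v`, an embedding adapted to `𝔓`, the spectral valuation
  obtain ⟨𝔐, h𝔐⟩ := v.localPrimesAbove_nonempty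
  obtain ⟨ι, hι⟩ := InertiaTame.exists_primeBelow_eq v h𝔓v h𝔐
  obtain ⟨w, hw⟩ := v.exists_spectralValuation
  -- `ℓ` is a uniformiser of `ℚ_v`
  have hgen : Rat.HeightOneSpectrum.natGenerator v = ℓ := hv
  have hπ : v.valuation ℚ ((ℓ : ℕ) : ℚ) = WithZero.exp (-1 : ℤ) := by
    rw [← hgen]
    exact Literature.NumberTheory.GaloisRepresentations.Rat.valuation_natGenerator v
  have hϖ := InertiaTame.irreducible_algebraMap v hπ
  -- the norm identity `|ι z|^d · |ℓ|_v = 1`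
  have hone : (placeOver ℓ).valuation (z ^ d * (ℓ : AlgebraicClosure ℚ)) = 1 := by
    rw [map_mul, map_pow]; exact hz
  have hone' : w (ι (z ^ d * (ℓ : AlgebraicClosure ℚ))) = 1 :=
    (valuation_placeOver_eq_one_iff_spectralValuation_eq_one ℓ hw h𝔐 ι hmem hι _).mp hone
  have hnorm : algNorm (v.adicCompletion ℚ) (ι z) ^ d *
      algNorm (v.adicCompletion ℚ) ((ℓ : ℕ) : AlgebraicClosure (v.adicCompletion ℚ)) = 1 := by
    have h1 := (HeightOneSpectrum.spectralValuation_eq_one_iff_algNorm_eq_one hw _).mp hone'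
    rwa [map_mul, map_pow, algNorm_mul, algNorm_pow, map_natCast ι] at h1
  -- the local orbit theorem (`CharZero ℚ_v` is introduced only inside this step: as an ambient
  -- instance it would make `DivisionRing.toRatAlgebra` compete with `instAlgebraAdicCompletion`)
  obtain ⟨σ, hσI, hinj⟩ : ∃ σ : Fin d → absoluteGaloisGroup (v.adicCompletion ℚ),
      (∀ i, σ i ∈ absInertia (v.adicCompletion ℚ)) ∧ Function.Injective fun i ↦ σ i • ι z := by
    haveI : CharZero (v.adicCompletion ℚ) :=
      charZero_of_injective_algebraMap (algebraMap ℚ (v.adicCompletion ℚ)).injective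
    exact exists_absInertia_smul_injective_of_algNorm_pow_mul_eq_one (z := ι z) hd hϖ (by
      rw [algebraMap_integer_algebraicClosure_apply]
      simp only [map_natCast]
      exact hnorm)
  -- transport along `ι`
  have happly : ∀ (s : absoluteGaloisGroup (v.adicCompletion ℚ)) (x : AlgebraicClosure ℚ),
      ι (resGalOfEmb ι s • x) = s • ι x := fun s x ↦ by
    have h := apply_resGalAuxOfEmb_apply ι s x
    rw [← resGalOfEmb_apply] at h
    exact h
  refine ⟨fun i ↦ resGalOfEmb ι (σ i), fun i ↦ ?_, fun i j hij ↦ hinj ?_⟩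
  · have hσ𝔐 : σ i ∈ 𝔐.inertia (absoluteGaloisGroup (v.adicCompletion ℚ)) := by
      rw [HeightOneSpectrum.inertia_eq_absInertia hw h𝔐]; exact hσI i
    rw [← hι]
    exact v.resGalOfEmb_mem_inertia_primeBelow ι 𝔐 hσ𝔐
  · have h : resGalOfEmb ι (σ i) • z = resGalOfEmb ι (σ j) • z := hij
    have h' := congrArg ι h
    rw [happly, happly] at h'
    exact h'

end Literature.NumberTheory.EllipticCurves

end
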